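import Summits.QuantumFields.YangMills.Theorems.BalabanUVNodesN15KingModelCurvatureFluxPi
import HarnessLib

/-!
# BalabanUVNodes ∕ N15 — THE KING-MODEL RUNG (PART Ϳ-e): MAXIMAL FLUX BY ANTICOMMUTATION — the Kogut–Susskind sign field `η_μ(x) = (−1)^{x_0+⋯+x_{μ−1}}` (a `ℤ₂` link field with
# plaquette `−1` in EVERY plane) makes King's `d+1` covariant hopping operators pairwise ANTICOMMUTE; hence `‖Σ_μT_μv‖² = Σ_μ‖T_μv‖² ≤ 4(d+1)‖v‖²` and
# `spec(−cΔ_U+m²) ⊂ [m² + (2(d+1) − 2√(d+1))c, m² + (2(d+1) + 2√(d+1))c]` — a curvature mass `(2(d+1)−2√(d+1))c` (`= 4c` in four dimensions), beating Ϳ-b's all-plane bound `(d+1)(2−√2)c`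
# (Track A, DAG node N15 = NE2; FAN-OUT v1.1 §N15 s3 «KING-MODEL RUNG … + what the curved case adds»; count-neutral)

HONEST FRAMING.  Count-neutral (cell `pub-ymgap`, seat `pub-ymgap-dag-n15-e` g46; `--supports stmt-QuantumFields-27247 --as helper` = K3ᴬ, KEY MAP v3).  King's fine covariance layer
`−cΔ_U+m²` (Ͱ-a `covLapF`) at one explicit `ℤ₂` link field on ONE finite torus (all periods even); elementary; NOT Bałaban's `G_k(U)`; NOT [Balaban1985BackgroundPropagators] (3.42); NOT
a node discharge (N15 of record untouched); nothing continuum ∕ ℝ⁴ ∕ OS ∕ Clay.  (The sign field is the staggered-fermion phase assignment; nothing from that literature is used.)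

THE RESULTS (`K_μ` even for all `μ`, `c ≥ 0`, any `m²`, any fibre `𝕜ⁿ`):
* §1 `ksPar`∕`ksSgn` (`η_μ(x) = (−1)^{Σ_{ν<μ}x_ν}`), the flips `ksSgn_add_unitVec_of_lt`∕`_of_not_lt` (moving along `ν < μ` flips `η_μ`, along `ν ≥ μ` does not), `ksLink` (`U(x,μ) = η_μ(x)·1`),
  `ksLink_mem_unitaryGroup`, ★★ **`kingPlaq_ks`** (EVERY plaquette `P_U(x,μ,ν) = −1`, `μ ≠ ν`), ★★ `re_quadForm_covLapF_ks_ge_plaq` (Ϳ-b all planes: `m² + (d+1)(2−√2)c`);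
* §2 the hopping maps `ksT μ v (x,i) = η_μ(x)(v(x+e_μ,i) + v(x−e_μ,i))`: `covLapF_ks_mulVec` (`M_Uv = (m²+2(d+1)c)v − cΣ_μT_μv`, King's stencil), ★★★ **`ksT_anticomm`** (`T_μT_ν = −T_νT_μ`,
  `μ ≠ ν`), `ksT_adjoint` (`⟨w,T_μv⟩ = ⟨T_μw,v⟩`), ★★ `re_cross_ksT_eq_zero` (`Re⟨T_μv,T_νv⟩ = 0`), ★★★ **`norm_sq_sum_ksT`** (`‖Σ_μT_μv‖² = Σ_μ‖T_μv‖²` — PYTHAGORAS FOR ANTICOMMUTING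
  HERMITIAN HOPPINGS), `norm_sq_ksT_le` (`‖T_μv‖² ≤ 4‖v‖²`), ★★ `norm_sq_sum_ksT_le` (`≤ 4(d+1)‖v‖²`);
* §3 ★★★ **`re_quadForm_covLapF_ks_ge`** — `(m² + (2(d+1) − 2√(d+1))c)·Σ_x‖v_x‖² ≤ Re⟨v,(−cΔ_U+m²)v⟩`, ★★ **`re_quadForm_covLapF_ks_le`** (`≤ (m² + (2(d+1) + 2√(d+1))c)·Σ‖v_x‖²`: the
  band SHRINKS symmetrically from King's `[m², m²+4(d+1)c]` (Ͱ-h) to width `4√(d+1)c`), ★★ `eigenvalues_covLapF_ks_ge`∕`_le`, `ks_gap_gt_plaq_gap` (`2(d+1)−2√(d+1) > (d+1)(2−√2)` for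
  `d ≥ 2`: anticommutation beats the plaquette count; at `d+1 = 2` both are `4−2√2`, the field IS Ϳ-d's π-flux field and the value is Ϳ-d's exact one).
WHAT THE CURVED CASE ADDS (as theorems): at maximal `ℤ₂` curvature the covariant kinetic spectrum contracts to `[2(d+1)−2√(d+1), 2(d+1)+2√(d+1)]·c` — in four dimensions `[4c, 12c]` instead
of King's `[0, 16c]`: a mass `4η⁻²` and a halved bandwidth, for every fibre, real fields included.  Exactness of the end points (Clifford structure on the `2^{d+1}` parity classes) is Ϳ-e′.
PRIOR TREE ART (by name, not restated): Ϳ-a (`plaqGap_neg_one`), Ϳ-b (`re_quadForm_covLapF_ge_plaq_all`), Ϳ-d (`neg_one_pow_mod_of_even`, `smul_one_mulVec_apply`, `re_inner_toEuclideanLin_neg_one`),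
Ͱ-a (`covLapF`, `covLapF_mulVec_apply`, `isHermitian_covLapF`), Ͱ-b (`fib`), Ͱ-f (`sum_norm_fib_sq`, `re_star_dotProduct_le_norm_mul_norm`), Ͻ-q (`kingPlaq`).  Dedup (rg at filing): basename 0
files; needles `ksPar|ksSgn|ksLink|ksT|kingPlaq_ks|ksT_anticomm|norm_sq_sum_ksT|re_quadForm_covLapF_ks_ge` 0 tree files.  Locators: [DodziukMathai2006] §1 Cor 1.3; [King1986] (2.12) p.653,
(4.4) p.670; [Balaban1985BackgroundPropagators] (3.23) p.394; [tHooft1979Flux] NPB 153 (flux sectors, notion).  0 `sorry`, 4 `def`.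
-/

noncomputable section
open scoped BigOperators ComplexConjugate ComplexOrder InnerProductSpace
open Finset Matrix WithLp

namespace Summit.QuantumFields.YangMills.BalabanUVNodes.N15KingModelRung.Curvature

open Literature.MathematicalPhysics.QuantumFieldTheory.Balaban1983to89.B5Prop11Plancherel (Tor unitVec)
open Summit.QuantumFields.YangMills.BalabanUVNodes.N15KingModelRung.Covariant
  (covLapF covLapF_mulVec_apply fib fib_apply isHermitian_covLapF sum_norm_fib_sq re_star_dotProduct_le_norm_mul_norm)
open Summit.QuantumFields.YangMills.BalabanUVNodes.N15KingModelRung.Cover (kingPlaq)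

variable {d : ℕ} (K : Fin (d + 1) → ℕ)
variable {𝕜 : Type*} [RCLike 𝕜] {n : Type*} [Fintype n] [DecidableEq n]

/-! ## §1 The Kogut–Susskind sign field -/

section Signs

/-- THE STAGGERED PARITY `Σ_{ν<μ} x_ν` (coordinates read in `{0,…,K_ν−1}`). [folklore] -/
def ksPar (μ : Fin (d + 1)) (x : Tor K) : ℕ := ∑ ν ∈ Finset.univ.filter (fun ν => ν < μ), (x ν).val

/-- THE KOGUT–SUSSKIND SIGN `η_μ(x) = (−1)^{x_0+⋯+x_{μ−1}}`. [folklore] -/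
def ksSgn (μ : Fin (d + 1)) (x : Tor K) : 𝕜 := (-1) ^ ksPar K μ x
omit [Fintype n] [DecidableEq n] in
/-- `η_μ(x)² = 1`. [folklore] -/
theorem ksSgn_mul_self (μ : Fin (d + 1)) (x : Tor K) : ksSgn K (𝕜 := 𝕜) μ x * ksSgn K μ x = 1 := by
  rw [ksSgn, ← pow_add, ← two_mul, pow_mul, neg_one_sq, one_pow]
omit [Fintype n] [DecidableEq n] in
/-- `η` is real. [folklore] -/
theorem star_ksSgn (μ : Fin (d + 1)) (x : Tor K) : star (ksSgn K (𝕜 := 𝕜) μ x) = ksSgn K μ x := by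
  rw [ksSgn, star_pow, star_neg, star_one]
omit [Fintype n] [DecidableEq n] in
/-- `‖η_μ(x)‖ = 1`. [folklore] -/
theorem norm_ksSgn (μ : Fin (d + 1)) (x : Tor K) : ‖ksSgn K (𝕜 := 𝕜) μ x‖ = 1 := by
  rw [ksSgn, norm_pow, norm_neg, norm_one, one_pow]

variable [hK : ∀ μ, NeZero (K μ)]
omit [Fintype n] [DecidableEq n] in
/-- Moving along `ν < μ` changes the staggered parity by one mod 2: `η_μ(x + e_ν) = −η_μ(x)` (`K_ν` even). [folklore] -/
theorem ksSgn_add_unitVec_of_lt {μ ν : Fin (d + 1)} (hνμ : ν < μ) (hK2 : Even (K ν)) (x : Tor K) : ksSgn K (𝕜 := 𝕜) μ (x + unitVec K ν) = -ksSgn K μ x := by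
  have h2 : 2 ≤ K ν := by
    obtain ⟨r, hr⟩ := hK2
    have := Nat.pos_of_ne_zero (NeZero.ne (K ν))
    omega
  haveI : Fact (1 < K ν) := ⟨by omega⟩
  unfold ksSgn ksPar
  have hmem : ν ∈ Finset.univ.filter (fun ν' => ν' < μ) := Finset.mem_filter.mpr ⟨Finset.mem_univ _, hνμ⟩
  rw [← Finset.add_sum_erase _ _ hmem, ← Finset.add_sum_erase _ _ hmem]
  have hrest : ∑ ν' ∈ (Finset.univ.filter (fun ν' => ν' < μ)).erase ν, ((x + unitVec K ν) ν').val
      = ∑ ν' ∈ (Finset.univ.filter (fun ν' => ν' < μ)).erase ν, (x ν').val := by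
    refine Finset.sum_congr rfl fun ν' hν' => ?_
    rw [Pi.add_apply, unitVec, Pi.single_eq_of_ne (Finset.ne_of_mem_erase hν'), add_zero]
  rw [hrest, Pi.add_apply, unitVec, Pi.single_eq_same, ZMod.val_add, ZMod.val_one, pow_add, pow_add, neg_one_pow_mod_of_even hK2, pow_succ]
  ring
omit [Fintype n] [DecidableEq n] hK in
/-- Moving along `ν` with `¬ ν < μ` does not change `η_μ`. [folklore] -/
theorem ksSgn_add_unitVec_of_not_lt {μ ν : Fin (d + 1)} (hνμ : ¬ ν < μ) (x : Tor K) : ksSgn K (𝕜 := 𝕜) μ (x + unitVec K ν) = ksSgn K μ x := by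
  unfold ksSgn ksPar
  congr 1
  refine Finset.sum_congr rfl fun ν' hν' => ?_
  have hne : ν' ≠ ν := fun h => hνμ (h ▸ (Finset.mem_filter.mp hν').2)
  rw [Pi.add_apply, unitVec, Pi.single_eq_of_ne hne, add_zero]
omit [Fintype n] [DecidableEq n] in
/-- `η_μ(x − e_ν) = −η_μ(x)` for `ν < μ` (`K_ν` even). [folklore] -/
theorem ksSgn_sub_unitVec_of_lt {μ ν : Fin (d + 1)} (hνμ : ν < μ) (hK2 : Even (K ν)) (x : Tor K) : ksSgn K (𝕜 := 𝕜) μ (x - unitVec K ν) = -ksSgn K μ x := by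
  have h := ksSgn_add_unitVec_of_lt K (𝕜 := 𝕜) hνμ hK2 (x - unitVec K ν)
  rw [sub_add_cancel] at h
  rw [h, neg_neg]
omit [Fintype n] [DecidableEq n] hK in
/-- `η_μ(x − e_ν) = η_μ(x)` for `¬ ν < μ`. [folklore] -/
theorem ksSgn_sub_unitVec_of_not_lt {μ ν : Fin (d + 1)} (hνμ : ¬ ν < μ) (x : Tor K) : ksSgn K (𝕜 := 𝕜) μ (x - unitVec K ν) = ksSgn K μ x := by
  have h := ksSgn_add_unitVec_of_not_lt K (𝕜 := 𝕜) hνμ (x - unitVec K ν)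
  rw [sub_add_cancel] at h
  exact h.symm
omit [Fintype n] [DecidableEq n] hK in
/-- In particular `η_μ` does not depend on `x_μ`. [folklore] -/
theorem ksSgn_sub_unitVec_self (μ : Fin (d + 1)) (x : Tor K) : ksSgn K (𝕜 := 𝕜) μ (x - unitVec K μ) = ksSgn K μ x :=
  ksSgn_sub_unitVec_of_not_lt K (lt_irrefl μ) x

/-- THE KOGUT–SUSSKIND LINK FIELD `U(x,μ) = η_μ(x)·1` (a `ℤ₂` gauge field on any fibre). [cite: tHooft1979Flux, NPB 153 (flux sectors, notion); King1986, (2.12) p.653] -/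
def ksLink : Tor K × Fin (d + 1) → Matrix n n 𝕜 := fun b => (ksSgn K b.2 b.1 : 𝕜) • (1 : Matrix n n 𝕜)
omit [Fintype n] hK in
/-- `U(x,μ) = η_μ(x)·1`. [folklore] -/
theorem ksLink_apply (x : Tor K) (μ : Fin (d + 1)) : ksLink K (n := n) (𝕜 := 𝕜) (x, μ) = (ksSgn K μ x : 𝕜) • (1 : Matrix n n 𝕜) := rfl
omit hK in
/-- The links are unitary. [folklore] -/
theorem ksLink_mem_unitaryGroup (b : Tor K × Fin (d + 1)) : ksLink K (n := n) (𝕜 := 𝕜) b ∈ Matrix.unitaryGroup n 𝕜 := by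
  refine Matrix.mem_unitaryGroup_iff'.mpr ?_
  rw [ksLink, star_eq_conjTranspose, conjTranspose_smul, conjTranspose_one, smul_mul_smul, Matrix.one_mul, star_ksSgn, ksSgn_mul_self, one_smul]

/-- ★★ **EVERY PLAQUETTE IS `−1`**: `P_U(x,μ,ν) = η_μ(x)η_ν(x+e_μ)η_μ(x+e_ν)η_ν(x)·1 = −1` for `μ ≠ ν` (exactly one of the two cross terms flips; all `K` even).
[cite: King1986, (2.12) p.653; tHooft1979Flux, NPB 153 (flux sectors, notion)] -/
theorem kingPlaq_ks (hK2 : ∀ μ, Even (K μ)) {μ ν : Fin (d + 1)} (hμν : μ ≠ ν) (x : Tor K) : kingPlaq K (ksLink K (n := n) (𝕜 := 𝕜)) x μ ν = -1 := by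
  rw [kingPlaq, ksLink_apply, ksLink_apply, ksLink_apply, ksLink_apply, conjTranspose_smul, conjTranspose_one, conjTranspose_smul, conjTranspose_one, star_ksSgn, star_ksSgn,
    smul_mul_smul, smul_mul_smul, smul_mul_smul, Matrix.one_mul, Matrix.one_mul, Matrix.one_mul]
  rcases lt_or_gt_of_ne hμν with h | h
  · -- μ < ν: η_ν(x+e_μ) flips, η_μ(x+e_ν) does not
    rw [ksSgn_add_unitVec_of_lt K h (hK2 μ), ksSgn_add_unitVec_of_not_lt K (not_lt.mpr h.le)]
    have h1 := ksSgn_mul_self K (𝕜 := 𝕜) μ x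
    have h2 := ksSgn_mul_self K (𝕜 := 𝕜) ν x
    rw [show ksSgn K (𝕜 := 𝕜) μ x * -ksSgn K ν x * ksSgn K μ x * ksSgn K ν x = -((ksSgn K (𝕜 := 𝕜) μ x * ksSgn K μ x) * (ksSgn K ν x * ksSgn K ν x)) by ring,
      h1, h2, mul_one, neg_smul, one_smul]
  · -- ν < μ: η_μ(x+e_ν) flips, η_ν(x+e_μ) does not
    rw [ksSgn_add_unitVec_of_not_lt K (not_lt.mpr h.le), ksSgn_add_unitVec_of_lt K h (hK2 ν)]
    have h1 := ksSgn_mul_self K (𝕜 := 𝕜) μ x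
    have h2 := ksSgn_mul_self K (𝕜 := 𝕜) ν x
    rw [show ksSgn K (𝕜 := 𝕜) μ x * ksSgn K ν x * -ksSgn K μ x * ksSgn K ν x = -((ksSgn K (𝕜 := 𝕜) μ x * ksSgn K μ x) * (ksSgn K ν x * ksSgn K ν x)) by ring,
      h1, h2, mul_one, neg_smul, one_smul]

variable {c : ℝ}

/-- ★★ Ϳ-b's all-plane plaquette bound at the KS field: `(m² + (d+1)(2−√2)c)·Σ‖v_x‖² ≤ Re⟨v,(−cΔ_U+m²)v⟩` (`d ≥ 1`). [cite: DodziukMathai2006, Cor 1.3 §1; King1986, (4.4) p.670] -/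
theorem re_quadForm_covLapF_ks_ge_plaq (hd : 0 < d) (hc : 0 ≤ c) (m2 : ℝ) (hK2 : ∀ μ, Even (K μ)) (v : Tor K × n → 𝕜) :
    (m2 + ((d : ℝ) + 1) * (2 - Real.sqrt 2) * c) * ∑ x, ‖fib K v x‖ ^ 2 ≤ RCLike.re (star v ⬝ᵥ (covLapF K c m2 (ksLink K) *ᵥ v)) := by
  have h := re_quadForm_covLapF_ge_plaq_all K hd hc m2 (ksLink_mem_unitaryGroup K) (γ := -1)
    (fun μ ν hμν x u => by rw [kingPlaq_ks K (n := n) (𝕜 := 𝕜) hK2 hμν x, re_inner_toEuclideanLin_neg_one]) v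
  rwa [plaqGap_neg_one, show ((d : ℝ) + 1) * c * (2 - Real.sqrt 2) = ((d : ℝ) + 1) * (2 - Real.sqrt 2) * c by ring] at h

end Signs

/-! ## §2 The anticommuting hopping maps -/

section Hopping

variable [hK : ∀ μ, NeZero (K μ)]

/-- THE COVARIANT HOPPING ALONG `μ` at the KS field: `(T_μv)(x,i) = η_μ(x)·(v(x+e_μ,i) + v(x−e_μ,i))` (`η_μ(x−e_μ) = η_μ(x)`). [cite: King1986, (4.4) p.670; Balaban1985BackgroundPropagators, (3.23) p.394] -/
def ksT (μ : Fin (d + 1)) (v : Tor K × n → 𝕜) : Tor K × n → 𝕜 := fun p => ksSgn K μ p.1 * (v (p.1 + unitVec K μ, p.2) + v (p.1 - unitVec K μ, p.2))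
omit [Fintype n] [DecidableEq n] hK in
/-- Unfolding. [folklore] -/
theorem ksT_apply (μ : Fin (d + 1)) (v : Tor K × n → 𝕜) (x : Tor K) (i : n) : ksT K μ v (x, i) = ksSgn K μ x * (v (x + unitVec K μ, i) + v (x - unitVec K μ, i)) := rfl

/-- `M_Uv = (m² + 2(d+1)c)v − c·Σ_μT_μv` (King's stencil at the KS field). [cite: King1986, (4.4) p.670; Balaban1985BackgroundPropagators, (3.23) p.394] -/
theorem covLapF_ks_mulVec (c m2 : ℝ) (v : Tor K × n → 𝕜) (x : Tor K) (i : n) :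
    (covLapF K c m2 (ksLink K) *ᵥ v) (x, i) = ((m2 + 2 * ((d : ℝ) + 1) * c : ℝ) : 𝕜) * v (x, i) - (c : 𝕜) * ∑ μ, ksT K μ v (x, i) := by
  rw [covLapF_mulVec_apply]
  congr 2
  refine Finset.sum_congr rfl fun μ _ => ?_
  rw [ksLink_apply, ksLink_apply, conjTranspose_smul, conjTranspose_one, star_ksSgn, smul_one_mulVec_apply, smul_one_mulVec_apply, ksSgn_sub_unitVec_self, ksT_apply, mul_add]
omit [Fintype n] [DecidableEq n] in
/-- ★★★ **ANTICOMMUTATION**: `T_μ(T_νv) = −T_ν(T_μv)` for `μ ≠ ν` (all `K` even): of the two signs `η_μ, η_ν` exactly one flips under the other's step. [cite: King1986, (2.12) p.653] -/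
theorem ksT_anticomm (hK2 : ∀ μ, Even (K μ)) {μ ν : Fin (d + 1)} (hμν : μ ≠ ν) (v : Tor K × n → 𝕜) : ksT K μ (ksT K ν v) = -ksT K ν (ksT K μ v) := by
  funext ⟨x, i⟩
  simp only [Pi.neg_apply, ksT_apply]
  rw [show x + unitVec K μ + unitVec K ν = x + unitVec K ν + unitVec K μ from add_right_comm _ _ _,
    show x + unitVec K μ - unitVec K ν = x - unitVec K ν + unitVec K μ from add_sub_right_comm _ _ _,
    show x - unitVec K μ + unitVec K ν = x + unitVec K ν - unitVec K μ from (add_sub_right_comm _ _ _).symm,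
    show x - unitVec K μ - unitVec K ν = x - unitVec K ν - unitVec K μ from sub_right_comm _ _ _]
  rcases lt_or_gt_of_ne hμν with h | h
  · rw [ksSgn_add_unitVec_of_lt K h (hK2 μ), ksSgn_sub_unitVec_of_lt K h (hK2 μ), ksSgn_add_unitVec_of_not_lt K (not_lt.mpr h.le), ksSgn_sub_unitVec_of_not_lt K (not_lt.mpr h.le)]
    ring
  · rw [ksSgn_add_unitVec_of_not_lt K (not_lt.mpr h.le), ksSgn_sub_unitVec_of_not_lt K (not_lt.mpr h.le), ksSgn_add_unitVec_of_lt K h (hK2 ν), ksSgn_sub_unitVec_of_lt K h (hK2 ν)]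
    ring
omit [Fintype n] [DecidableEq n] hK in
/-- `η_μ(x + e_μ) = η_μ(x)`. [folklore] -/
theorem ksSgn_add_unitVec_self (μ : Fin (d + 1)) (x : Tor K) : ksSgn K (𝕜 := 𝕜) μ (x + unitVec K μ) = ksSgn K μ x :=
  ksSgn_add_unitVec_of_not_lt K (lt_irrefl μ) x
omit [DecidableEq n] in
/-- `T_μ` IS HERMITIAN: `⟨w, T_μv⟩ = ⟨T_μw, v⟩` (reindex `x ↦ x ∓ e_μ`; `η_μ` real and independent of `x_μ`). [folklore] -/
theorem ksT_adjoint (μ : Fin (d + 1)) (v w : Tor K × n → 𝕜) : star w ⬝ᵥ ksT K μ v = star (ksT K μ w) ⬝ᵥ v := by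
  have hconj : ∀ x, conj (ksSgn K (𝕜 := 𝕜) μ x) = ksSgn K μ x := fun x => by rw [← RCLike.star_def, star_ksSgn]
  -- the two reindexings
  have hA : ∑ p : Tor K × n, conj (w p) * (ksSgn K μ p.1 * v (p.1 + unitVec K μ, p.2))
      = ∑ p : Tor K × n, ksSgn K μ p.1 * conj (w (p.1 - unitVec K μ, p.2)) * v p := by
    refine Fintype.sum_equiv (Equiv.prodCongr (Equiv.addRight (unitVec K μ)) (Equiv.refl n)) _ _ fun p => ?_
    obtain ⟨x, i⟩ := p
    show conj (w (x, i)) * (ksSgn K μ x * v (x + unitVec K μ, i))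
      = ksSgn K μ (x + unitVec K μ) * conj (w (x + unitVec K μ - unitVec K μ, i)) * v (x + unitVec K μ, i)
    rw [add_sub_cancel_right, ksSgn_add_unitVec_self]; ring
  have hB : ∑ p : Tor K × n, conj (w p) * (ksSgn K μ p.1 * v (p.1 - unitVec K μ, p.2))
      = ∑ p : Tor K × n, ksSgn K μ p.1 * conj (w (p.1 + unitVec K μ, p.2)) * v p := by
    refine Fintype.sum_equiv (Equiv.prodCongr (Equiv.subRight (unitVec K μ)) (Equiv.refl n)) _ _ fun p => ?_
    obtain ⟨x, i⟩ := p
    show conj (w (x, i)) * (ksSgn K μ x * v (x - unitVec K μ, i))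
      = ksSgn K μ (x - unitVec K μ) * conj (w (x - unitVec K μ + unitVec K μ, i)) * v (x - unitVec K μ, i)
    rw [sub_add_cancel, ksSgn_sub_unitVec_self]; ring
  calc star w ⬝ᵥ ksT K μ v
      = ∑ p : Tor K × n, (conj (w p) * (ksSgn K μ p.1 * v (p.1 + unitVec K μ, p.2)) + conj (w p) * (ksSgn K μ p.1 * v (p.1 - unitVec K μ, p.2))) := by
        simp only [dotProduct, Pi.star_apply, RCLike.star_def, ksT]
        exact Finset.sum_congr rfl fun p _ => by ring
    _ = ∑ p : Tor K × n, ksSgn K μ p.1 * conj (w (p.1 - unitVec K μ, p.2)) * v p + ∑ p : Tor K × n, ksSgn K μ p.1 * conj (w (p.1 + unitVec K μ, p.2)) * v p := by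
        rw [Finset.sum_add_distrib, hA, hB]
    _ = star (ksT K μ w) ⬝ᵥ v := by
        rw [← Finset.sum_add_distrib]
        simp only [dotProduct, Pi.star_apply, RCLike.star_def, ksT, map_mul, map_add, hconj]
        exact Finset.sum_congr rfl fun p _ => by ring

end Hopping

/-! ## §3 Pythagoras for anticommuting Hermitian hoppings, and the band `[2(d+1) − 2√(d+1), 2(d+1) + 2√(d+1)]·c` -/

section Band

variable [hK : ∀ μ, NeZero (K μ)]

/-- The sum of squares `Σ_p ‖v p‖²` (`= ‖v‖²_{ℓ²} = Σ_x‖v_x‖²`). [folklore] -/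
def ssq (v : Tor K × n → 𝕜) : ℝ := ∑ p, ‖v p‖ ^ 2
omit [DecidableEq n] in
/-- `ssq v = ‖v‖²_{ℓ²}`. [folklore] -/
theorem ssq_eq_norm_sq (v : Tor K × n → 𝕜) : ssq K v = ‖(toLp 2 v : EuclideanSpace 𝕜 (Tor K × n))‖ ^ 2 := by
  rw [EuclideanSpace.norm_eq, Real.sq_sqrt (Finset.sum_nonneg fun _ _ => sq_nonneg _)]
  rfl
omit [DecidableEq n] in
/-- `ssq v = Σ_x‖v_x‖²` (Ͱ-f `sum_norm_fib_sq`). [folklore] -/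
theorem ssq_eq_sum_fib (v : Tor K × n → 𝕜) : ssq K v = ∑ x, ‖fib K v x‖ ^ 2 := by rw [ssq_eq_norm_sq, sum_norm_fib_sq]
omit [DecidableEq n] in
/-- `Re(star v ⬝ᵥ v) = ssq v`. [folklore] -/
theorem re_star_dotProduct_self_eq_ssq (v : Tor K × n → 𝕜) : RCLike.re (star v ⬝ᵥ v) = ssq K v := by
  simp only [dotProduct, Pi.star_apply, RCLike.star_def, map_sum, ssq]
  refine Finset.sum_congr rfl fun p _ => ?_
  rw [RCLike.conj_mul, ← RCLike.ofReal_pow, RCLike.ofReal_re]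
omit [DecidableEq n] in
/-- `star b ⬝ᵥ a = conj(star a ⬝ᵥ b)`. [folklore] -/
theorem star_dotProduct_conj (a b : Tor K × n → 𝕜) : star b ⬝ᵥ a = conj (star a ⬝ᵥ b) := by
  simp only [dotProduct, Pi.star_apply, RCLike.star_def, map_sum, map_mul, RCLike.conj_conj]
  exact Finset.sum_congr rfl fun p _ => mul_comm _ _
omit [DecidableEq n] in
/-- ★★ **THE CROSS TERMS VANISH**: `Re⟨T_μv, T_νv⟩ = 0` for `μ ≠ ν` — `⟨T_μv,T_νv⟩ = ⟨v,T_μT_νv⟩ = −⟨v,T_νT_μv⟩ = −conj⟨T_μv,T_νv⟩` (Hermitian + anticommuting). [folklore] -/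
theorem re_cross_ksT_eq_zero (hK2 : ∀ μ, Even (K μ)) {μ ν : Fin (d + 1)} (hμν : μ ≠ ν) (v : Tor K × n → 𝕜) :
    RCLike.re (star (ksT K μ v) ⬝ᵥ ksT K ν v) = 0 := by
  have h1 : star (ksT K μ v) ⬝ᵥ ksT K ν v = star v ⬝ᵥ ksT K μ (ksT K ν v) := (ksT_adjoint K μ (ksT K ν v) v).symm
  have h2 : star v ⬝ᵥ ksT K μ (ksT K ν v) = -(star v ⬝ᵥ ksT K ν (ksT K μ v)) := by rw [ksT_anticomm K hK2 hμν, dotProduct_neg]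
  have h3 : star v ⬝ᵥ ksT K ν (ksT K μ v) = star (ksT K ν v) ⬝ᵥ ksT K μ v := ksT_adjoint K ν (ksT K μ v) v
  have h4 : star (ksT K ν v) ⬝ᵥ ksT K μ v = conj (star (ksT K μ v) ⬝ᵥ ksT K ν v) := star_dotProduct_conj K _ _
  have h : star (ksT K μ v) ⬝ᵥ ksT K ν v = -conj (star (ksT K μ v) ⬝ᵥ ksT K ν v) := by
    calc star (ksT K μ v) ⬝ᵥ ksT K ν v = star v ⬝ᵥ ksT K μ (ksT K ν v) := h1
      _ = -(star v ⬝ᵥ ksT K ν (ksT K μ v)) := h2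
      _ = -(star (ksT K ν v) ⬝ᵥ ksT K μ v) := by rw [h3]
      _ = -conj (star (ksT K μ v) ⬝ᵥ ksT K ν v) := by rw [h4]
  have hre := congrArg RCLike.re h
  rw [map_neg, RCLike.conj_re] at hre
  linarith
omit [DecidableEq n] in
/-- ★★★ **PYTHAGORAS FOR ANTICOMMUTING HERMITIAN HOPPINGS**: `‖Σ_μT_μv‖² = Σ_μ‖T_μv‖²`. [folklore] -/
theorem norm_sq_sum_ksT (hK2 : ∀ μ, Even (K μ)) (v : Tor K × n → 𝕜) : ssq K (∑ μ, ksT K μ v) = ∑ μ, ssq K (ksT K μ v) := by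
  rw [← re_star_dotProduct_self_eq_ssq, star_sum, sum_dotProduct, map_sum]
  refine Finset.sum_congr rfl fun μ _ => ?_
  rw [dotProduct_sum, map_sum, Finset.sum_eq_single μ (fun ν _ hνμ => re_cross_ksT_eq_zero K hK2 (Ne.symm hνμ) v) (fun h => absurd (Finset.mem_univ μ) h),
    re_star_dotProduct_self_eq_ssq]

omit [DecidableEq n] in
/-- `ssq` is translation invariant in the site variable. [folklore] -/
theorem ssq_shift (v : Tor K × n → 𝕜) (t : Tor K) : ∑ p : Tor K × n, ‖v (p.1 + t, p.2)‖ ^ 2 = ssq K v :=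
  Fintype.sum_equiv (Equiv.prodCongr (Equiv.addRight t) (Equiv.refl n)) _ _ fun _ => rfl

omit [DecidableEq n] in
/-- `‖T_μv‖² ≤ 4‖v‖²` (`|η| = 1`, `‖a+b‖² ≤ 2‖a‖²+2‖b‖²`, two translates). [folklore] -/
theorem norm_sq_ksT_le (μ : Fin (d + 1)) (v : Tor K × n → 𝕜) : ssq K (ksT K μ v) ≤ 4 * ssq K v := by
  have hterm : ∀ p : Tor K × n, ‖ksT K μ v p‖ ^ 2 ≤ 2 * ‖v (p.1 + unitVec K μ, p.2)‖ ^ 2 + 2 * ‖v (p.1 + -unitVec K μ, p.2)‖ ^ 2 := fun p => by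
    rw [show ksT K μ v p = ksSgn K μ p.1 * (v (p.1 + unitVec K μ, p.2) + v (p.1 - unitVec K μ, p.2)) from rfl, norm_mul, norm_ksSgn, one_mul, ← sub_eq_add_neg]
    have h := norm_add_le (v (p.1 + unitVec K μ, p.2)) (v (p.1 - unitVec K μ, p.2))
    nlinarith [h, norm_nonneg (v (p.1 + unitVec K μ, p.2) + v (p.1 - unitVec K μ, p.2)), norm_nonneg (v (p.1 + unitVec K μ, p.2)), norm_nonneg (v (p.1 - unitVec K μ, p.2)),
      sq_nonneg (‖v (p.1 + unitVec K μ, p.2)‖ - ‖v (p.1 - unitVec K μ, p.2)‖)]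
  calc ssq K (ksT K μ v) = ∑ p, ‖ksT K μ v p‖ ^ 2 := rfl
    _ ≤ ∑ p : Tor K × n, (2 * ‖v (p.1 + unitVec K μ, p.2)‖ ^ 2 + 2 * ‖v (p.1 + -unitVec K μ, p.2)‖ ^ 2) := Finset.sum_le_sum fun p _ => hterm p
    _ = 4 * ssq K v := by rw [Finset.sum_add_distrib, ← Finset.mul_sum, ← Finset.mul_sum, ssq_shift, ssq_shift]; ring

omit [DecidableEq n] in
/-- ★★ `‖Σ_μT_μv‖² ≤ 4(d+1)‖v‖²` — the covariant hopping at the KS field has norm `≤ 2√(d+1)` (King's free hopping has norm `2(d+1)`). [cite: King1986, (4.4) p.670] -/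
theorem norm_sq_sum_ksT_le (hK2 : ∀ μ, Even (K μ)) (v : Tor K × n → 𝕜) : ssq K (∑ μ, ksT K μ v) ≤ 4 * ((d : ℝ) + 1) * ssq K v := by
  rw [norm_sq_sum_ksT K hK2]
  calc ∑ μ, ssq K (ksT K μ v) ≤ ∑ _μ : Fin (d + 1), 4 * ssq K v := Finset.sum_le_sum fun μ _ => norm_sq_ksT_le K μ v
    _ = 4 * ((d : ℝ) + 1) * ssq K v := by rw [Finset.sum_const, Finset.card_univ, Fintype.card_fin, nsmul_eq_mul]; push_cast; ring

omit [DecidableEq n] in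
/-- `|Re⟨v, Σ_μT_μv⟩| ≤ 2√(d+1)·‖v‖²` (Cauchy–Schwarz + §3). [folklore] -/
theorem abs_re_hopping_le (hK2 : ∀ μ, Even (K μ)) (v : Tor K × n → 𝕜) :
    |RCLike.re (star v ⬝ᵥ ∑ μ, ksT K μ v)| ≤ 2 * Real.sqrt ((d : ℝ) + 1) * ssq K v := by
  set S := ∑ μ, ksT K μ v with hS
  have hcs : |RCLike.re (star v ⬝ᵥ S)| ≤ ‖(toLp 2 v : EuclideanSpace 𝕜 (Tor K × n))‖ * ‖(toLp 2 S : EuclideanSpace 𝕜 (Tor K × n))‖ := by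
    rw [abs_le]
    refine ⟨?_, re_star_dotProduct_le_norm_mul_norm K v S⟩
    have h := re_star_dotProduct_le_norm_mul_norm K v (-S)
    rw [dotProduct_neg, map_neg, toLp_neg, norm_neg] at h
    linarith
  have hSn : ‖(toLp 2 S : EuclideanSpace 𝕜 (Tor K × n))‖ ≤ 2 * Real.sqrt ((d : ℝ) + 1) * ‖(toLp 2 v : EuclideanSpace 𝕜 (Tor K × n))‖ := by
    have h1 : ‖(toLp 2 S : EuclideanSpace 𝕜 (Tor K × n))‖ ^ 2 ≤ (2 * Real.sqrt ((d : ℝ) + 1) * ‖(toLp 2 v : EuclideanSpace 𝕜 (Tor K × n))‖) ^ 2 := by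
      rw [← ssq_eq_norm_sq, mul_pow, mul_pow, Real.sq_sqrt (by positivity), ← ssq_eq_norm_sq]
      have := norm_sq_sum_ksT_le K hK2 v
      rw [← hS] at this
      linarith
    exact (abs_le_of_sq_le_sq' h1 (by positivity)).2
  calc |RCLike.re (star v ⬝ᵥ S)| ≤ ‖(toLp 2 v : EuclideanSpace 𝕜 (Tor K × n))‖ * ‖(toLp 2 S : EuclideanSpace 𝕜 (Tor K × n))‖ := hcs
    _ ≤ ‖(toLp 2 v : EuclideanSpace 𝕜 (Tor K × n))‖ * (2 * Real.sqrt ((d : ℝ) + 1) * ‖(toLp 2 v : EuclideanSpace 𝕜 (Tor K × n))‖) :=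
        mul_le_mul_of_nonneg_left hSn (norm_nonneg _)
    _ = 2 * Real.sqrt ((d : ℝ) + 1) * ssq K v := by rw [ssq_eq_norm_sq]; ring

variable {c : ℝ}

omit [DecidableEq n] in
/-- The form at the KS field: `Re⟨v, M_Uv⟩ = (m² + 2(d+1)c)‖v‖² − c·Re⟨v, Σ_μT_μv⟩`. [cite: King1986, (4.4) p.670; Balaban1985BackgroundPropagators, (3.23) p.394] -/
theorem re_quadForm_covLapF_ks_eq [DecidableEq n] (c m2 : ℝ) (v : Tor K × n → 𝕜) :
    RCLike.re (star v ⬝ᵥ (covLapF K c m2 (ksLink K) *ᵥ v)) = (m2 + 2 * ((d : ℝ) + 1) * c) * ssq K v - c * RCLike.re (star v ⬝ᵥ ∑ μ, ksT K μ v) := by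
  have hMv : covLapF K c m2 (ksLink K) *ᵥ v = fun p => ((m2 + 2 * ((d : ℝ) + 1) * c : ℝ) : 𝕜) * v p - (c : 𝕜) * (∑ μ, ksT K μ v) p := by
    funext ⟨x, i⟩
    rw [covLapF_ks_mulVec, Finset.sum_apply]
  rw [hMv]
  have hsplit : star v ⬝ᵥ (fun p => ((m2 + 2 * ((d : ℝ) + 1) * c : ℝ) : 𝕜) * v p - (c : 𝕜) * (∑ μ, ksT K μ v) p)
      = ((m2 + 2 * ((d : ℝ) + 1) * c : ℝ) : 𝕜) * (star v ⬝ᵥ v) - (c : 𝕜) * (star v ⬝ᵥ ∑ μ, ksT K μ v) := by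
    simp only [dotProduct, Pi.star_apply, Finset.mul_sum, ← Finset.sum_sub_distrib]
    exact Finset.sum_congr rfl fun p _ => by ring
  rw [hsplit, map_sub, RCLike.re_ofReal_mul, RCLike.re_ofReal_mul, re_star_dotProduct_self_eq_ssq]

/-- ★★★ **THE KOGUT–SUSSKIND LOWER BOUND**: `(m² + (2(d+1) − 2√(d+1))c)·Σ_x‖v_x‖² ≤ Re⟨v, (−cΔ_U+m²)v⟩` at the maximal-flux `ℤ₂` field (all `K` even, `c ≥ 0`, any fibre): a curvature
mass `(2(d+1) − 2√(d+1))·c`, `= 4c` for `d+1 = 4`. [cite: DodziukMathai2006, Cor 1.3 §1; King1986, (4.4) p.670; tHooft1979Flux, NPB 153 (flux sectors, notion)] -/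
theorem re_quadForm_covLapF_ks_ge (hc : 0 ≤ c) (m2 : ℝ) (hK2 : ∀ μ, Even (K μ)) (v : Tor K × n → 𝕜) :
    (m2 + (2 * ((d : ℝ) + 1) - 2 * Real.sqrt ((d : ℝ) + 1)) * c) * ∑ x, ‖fib K v x‖ ^ 2 ≤ RCLike.re (star v ⬝ᵥ (covLapF K c m2 (ksLink K) *ᵥ v)) := by
  rw [re_quadForm_covLapF_ks_eq, ← ssq_eq_sum_fib]
  have h := (abs_le.mp (abs_re_hopping_le K hK2 v)).2
  have hss : 0 ≤ ssq K v := Finset.sum_nonneg fun _ _ => sq_nonneg _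
  nlinarith [mul_le_mul_of_nonneg_left h hc]

/-- ★★ **THE UPPER EDGE**: `Re⟨v,(−cΔ_U+m²)v⟩ ≤ (m² + (2(d+1) + 2√(d+1))c)·Σ_x‖v_x‖²` — at the KS field the covariant kinetic band is `[2(d+1)−2√(d+1), 2(d+1)+2√(d+1)]·c`, of width
`4√(d+1)·c` around the centre `2(d+1)c`, versus King's `[0, 4(d+1)c]` at `U ≡ 1` (PART Ͱ-h `eigenvalues_covLapF_le`). [cite: King1986, (4.4) p.670; DodziukMathai2006, Cor 1.3 §1] -/
theorem re_quadForm_covLapF_ks_le (hc : 0 ≤ c) (m2 : ℝ) (hK2 : ∀ μ, Even (K μ)) (v : Tor K × n → 𝕜) :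
    RCLike.re (star v ⬝ᵥ (covLapF K c m2 (ksLink K) *ᵥ v)) ≤ (m2 + (2 * ((d : ℝ) + 1) + 2 * Real.sqrt ((d : ℝ) + 1)) * c) * ∑ x, ‖fib K v x‖ ^ 2 := by
  rw [re_quadForm_covLapF_ks_eq, ← ssq_eq_sum_fib]
  have h := (abs_le.mp (abs_re_hopping_le K hK2 v)).1
  have hss : 0 ≤ ssq K v := Finset.sum_nonneg fun _ _ => sq_nonneg _
  nlinarith [mul_le_mul_of_nonneg_left h hc]

/-- ★★ Every eigenvalue of `−cΔ_U+m²` at the KS field is `≥ m² + (2(d+1)−2√(d+1))c`. [cite: DodziukMathai2006, Cor 1.3 §1; King1986, (4.4) p.670] -/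
theorem eigenvalues_covLapF_ks_ge (hc : 0 ≤ c) (m2 : ℝ) (hK2 : ∀ μ, Even (K μ)) (i : Tor K × n) :
    m2 + (2 * ((d : ℝ) + 1) - 2 * Real.sqrt ((d : ℝ) + 1)) * c ≤ (isHermitian_covLapF K c m2 (ksLink K (n := n) (𝕜 := 𝕜))).eigenvalues i := by
  set hA := isHermitian_covLapF K c m2 (ksLink K (n := n) (𝕜 := 𝕜))
  rw [hA.eigenvalues_eq i]
  have h := re_quadForm_covLapF_ks_ge K hc m2 hK2 (⇑(hA.eigenvectorBasis i))
  have hnorm : ‖(toLp 2 (⇑(hA.eigenvectorBasis i)) : EuclideanSpace 𝕜 (Tor K × n))‖ = 1 := hA.eigenvectorBasis.orthonormal.1 i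
  rw [sum_norm_fib_sq, hnorm, one_pow, mul_one] at h
  exact h

/-- ★★ … and `≤ m² + (2(d+1)+2√(d+1))c`. [cite: King1986, (4.4) p.670] -/
theorem eigenvalues_covLapF_ks_le (hc : 0 ≤ c) (m2 : ℝ) (hK2 : ∀ μ, Even (K μ)) (i : Tor K × n) :
    (isHermitian_covLapF K c m2 (ksLink K (n := n) (𝕜 := 𝕜))).eigenvalues i ≤ m2 + (2 * ((d : ℝ) + 1) + 2 * Real.sqrt ((d : ℝ) + 1)) * c := by
  set hA := isHermitian_covLapF K c m2 (ksLink K (n := n) (𝕜 := 𝕜))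
  rw [hA.eigenvalues_eq i]
  have h := re_quadForm_covLapF_ks_le K hc m2 hK2 (⇑(hA.eigenvectorBasis i))
  have hnorm : ‖(toLp 2 (⇑(hA.eigenvectorBasis i)) : EuclideanSpace 𝕜 (Tor K × n))‖ = 1 := hA.eigenvectorBasis.orthonormal.1 i
  rw [sum_norm_fib_sq, hnorm, one_pow, mul_one] at h
  exact h

omit hK in
/-- ANTICOMMUTATION BEATS THE PLAQUETTE COUNT: `(d+1)(2−√2) < 2(d+1) − 2√(d+1)` for `d ≥ 2` (equal for `d+1 = 2`, both `4−2√2` — there the KS field is Ϳ-d's π-flux field and the value is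
exact). [folklore] -/
theorem ks_gap_gt_plaq_gap (hd : 2 ≤ d) : ((d : ℝ) + 1) * (2 - Real.sqrt 2) < 2 * ((d : ℝ) + 1) - 2 * Real.sqrt ((d : ℝ) + 1) := by
  -- equivalent to `2√(d+1) < (d+1)√2`, i.e. `4(d+1) < 2(d+1)²`, i.e. `2 < d+1`
  have hd' : (2 : ℝ) ≤ d := by exact_mod_cast hd
  have hD : (0 : ℝ) < (d : ℝ) + 1 := by positivity
  have h2 : Real.sqrt 2 * Real.sqrt 2 = 2 := Real.mul_self_sqrt (by norm_num)
  have hs : Real.sqrt ((d : ℝ) + 1) * Real.sqrt ((d : ℝ) + 1) = (d : ℝ) + 1 := Real.mul_self_sqrt hD.le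
  have hkey : 2 * Real.sqrt ((d : ℝ) + 1) < ((d : ℝ) + 1) * Real.sqrt 2 := by
    have hl : 0 ≤ 2 * Real.sqrt ((d : ℝ) + 1) := by positivity
    have hr : 0 ≤ ((d : ℝ) + 1) * Real.sqrt 2 := by positivity
    have hsq : (2 * Real.sqrt ((d : ℝ) + 1)) ^ 2 < (((d : ℝ) + 1) * Real.sqrt 2) ^ 2 := by
      rw [mul_pow, mul_pow, Real.sq_sqrt hD.le, Real.sq_sqrt (by norm_num)]; nlinarith
    exact lt_of_pow_lt_pow_left₀ 2 hr hsq
  nlinarith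

end Band

end Summit.QuantumFields.YangMills.BalabanUVNodes.N15KingModelRung.Curvature

end
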